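import Literature.Computability.Cryptography.InaccessibleEntropyUOWHFMain
import Literature.Computability.Cryptography.UOWHFChainComposeSecurity
import HarnessLib

/-!
# One-way functions ⇒ a leveled factor-two restricted UOWHF

Topic `Literature/Computability/Cryptography`. Instantiates the fixed-level Merkle–Damgård composition
(`UOWHFChainCompose*.lean`; Goldreich 2004, Construction 6.4.22 / Prop. 6.4.23 at one level) at the leveled
`(d, d−1)`-restricted UOWHF `HHRVW.family p f` of `InaccessibleEntropyUOWHFMain.lean` (OWF ⇒ UOWHF, HHRVW 2020,
Thm. 5.1), with `R = d − 2` extra levels: the composed collection `HHRVW.compose2 p f` maps its restricted domain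
`{0,1}^{2(d−1)}` to `{0,1}^{d−1}` and is a leveled restricted UOWHF whenever `f` is a length-preserving one-way function
(`isLeveledRUOWHF_compose2`). This is the input to tree hashing (Goldreich's Steps III–IV). All statements proved; no
named facts.

## References

* O. Goldreich, *Foundations of Cryptography II*, CUP 2004, §6.4.3.2, Construction 6.4.22, Prop. 6.4.23.
* I. Haitner et al., *Inaccessible Entropy II*, Theory of Computing 16(8) (2020), Thm. 5.1.
-/

namespace Literature.Computability.Cryptography

namespace HHRVW

open _root_.Computability Complexity Complexity.Brick Polynomial Filter Asymptotics Sz MDCompose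

/-! ### Two more size facts -/

/-- `t ≥ 128`. [folklore] -/
theorem t_ge_128 (n : ℕ) : 128 ≤ t n := by
  have hM := M_pos n
  have hP : 1 ≤ P2X n := Nat.one_le_two_pow
  rw [t]; nlinarith

/-- `d ≥ 2` (indeed `d ≥ 128`). [folklore] -/
theorem two_le_d (n : ℕ) : 2 ≤ d n := by
  have ht := t_ge_128 n
  have hd0 := one_le_d0 n
  have h1 : 128 ≤ n2 n := by rw [n2]; nlinarith
  have h2 : 127 ≤ Nm1 n := by rw [Nm1, r3]; omega
  have h3 := one_le_Jp1 n
  rw [← Jp1_mul_Nm1]; nlinarith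

/-- `K ≥ 1`. [folklore] -/
theorem one_le_K (n : ℕ) : 1 ≤ K n := by
  have h1 := one_le_Jp1 n
  have h2 : 1 ≤ N n := by rw [N]; have := one_le_n2 n; omega
  rw [K]; exact Nat.mul_pos (Nat.mul_pos h1 (Nat.succ_pos _)) h2

/-! ### The specification -/

/-- A polynomial bound on `d`. [folklore] -/
noncomputable def Pd : Polynomial ℕ := Classical.choose (UExpr.exists_poly_le₁ E.d)

/-- `d n ≤ Pd(n)`. [folklore] -/
theorem d_le_Pd (n : ℕ) : d n ≤ Pd.eval n := by
  have h := Classical.choose_spec (UExpr.exists_poly_le₁ E.d) n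
  rw [E.d_eval] at h
  exact h

/-- The number of extra chain levels of the factor-two composition, `R = d − 2`. [cite: Goldreich2004, Construction 6.4.22] -/
def Rtwo (n : ℕ) : ℕ := d n - 2

/-- The size expression of `Rtwo` (kept as a named constant so that `compile₁` does not unfold on it). [folklore] -/
def ERtwo : UExpr := UExpr.sub E.d (UExpr.cst 2)

/-- The unary brick for `d` (a named constant, so that unification with the specification stays syntactic). [folklore] -/
noncomputable def dLFd : List Bool → List Bool := UExpr.compile₁ E.d

/-- The unary brick for `Rtwo`. [folklore] -/
noncomputable def RFtwo : List Bool → List Bool := UExpr.compile₁ ERtwo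

/-- `Rtwo ≤ Pd`. [folklore] -/
theorem Rtwo_le (n : ℕ) : Rtwo n ≤ Pd.eval n := (Nat.sub_le (d n) 2).trans (d_le_Pd n)

/-- `(Rtwo + 1)·p ≤ Pd·p`. [folklore] -/
theorem Rtwo_succ_mul_le (p : Polynomial ℕ) (n : ℕ) : (Rtwo n + 1) * p.eval n ≤ (Pd * p).eval n := by
  have h1 : Rtwo n + 1 ≤ Pd.eval n := by have := d_le_Pd n; have := two_le_d n; rw [Rtwo]; omega
  have h3 : (Pd * p).eval n = Pd.eval n * p.eval n := eval_mul
  exact (Nat.mul_le_mul_right _ h1).trans (le_of_eq h3.symm)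

variable (p : Polynomial ℕ) (f : List Bool → List Bool)

/-- **The specification of the factor-two composition** of `HHRVW.family p f`: basic brick `hashP p f` on `p(n)`
coins with domain `d(n)`, `R = d − 2` extra levels (domain `2(d−1)`, range `d − 1`), unary bricks compiled from the
size table, clock `Pd`, composed coins `Pd · p ≥ (d−1)·p`. [cite: Goldreich2004, Construction 6.4.22] -/
noncomputable def spec2 : MDCompose.Spec where
  hb := hashP p f
  p := p
  dL := d
  R := Rtwo
  dLF := dLFd
  RF := RFtwo
  PR := Pd
  p₂ := Pd * p

/-- The basic family of the specification is `HHRVW.family p f`. [folklore] -/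
theorem base_spec2 : MDCompose.base (spec2 p f) = family p f := rfl

variable {p f}

/-- Projection (by `rfl`; used as a rewrite rule to keep unification syntactic). [folklore] -/
theorem spec2_hb : (spec2 p f).hb = hashP p f := rfl
/-- Projection. [folklore] -/
theorem spec2_p : (spec2 p f).p = p := rfl
/-- Projection. [folklore] -/
theorem spec2_dL : (spec2 p f).dL = d := rfl
/-- Projection. [folklore] -/
theorem spec2_R : (spec2 p f).R = Rtwo := rfl
/-- Projection. [folklore] -/
theorem spec2_dLF : (spec2 p f).dLF = dLFd := rfl
/-- Projection (proved by the equation lemma: `rfl` on this field exhausts the recursion depth). [folklore] -/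
theorem spec2_RF : (spec2 p f).RF = RFtwo := by rw [spec2]
/-- Projection. [folklore] -/
theorem spec2_PR : (spec2 p f).PR = Pd := rfl
/-- Projection. [folklore] -/
theorem spec2_p₂ : (spec2 p f).p₂ = Pd * p := rfl

/-- The unary brick for `d`. [folklore] -/
theorem compile_d_apply (n : ℕ) : dLFd (ones n) = ones (d n) := by
  rw [dLFd, UExpr.compile₁_apply]
  simp only [ones, List.length_replicate]
  rw [E.d_eval]

/-- The unary brick for `R = d − 2`. [folklore] -/
theorem compile_Rtwo_apply (n : ℕ) : RFtwo (ones n) = ones (Rtwo n) := by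
  rw [RFtwo, UExpr.compile₁_apply, Rtwo, ERtwo]
  simp only [ones, List.length_replicate, UExpr.eval_sub, UExpr.eval_cst]
  rw [E.d_eval]

/-- The range of the basic brick on well-formed inputs: `d − 1`. [folklore] -/
theorem length_hashP_idx (n : ℕ) {r : List Bool} (hr : r.length = p.eval n) (x : List Bool) :
    (hashP p f (boolPair (ones n ++ false :: r) x)).length = d n - 1 := by
  have h := length_family_hash (p := p) f (ones n ++ false :: r) x
  rw [rLen, MDCompose.nOf_length_idx p n hr] at h
  have hd := Jp1_mul_Nm1 n
  have : (family p f).hash (ones n ++ false :: r) x = hashP p f (boolPair (ones n ++ false :: r) x) := rfl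
  rw [this] at h
  omega

/-- **Well-formedness** of the specification, for `f ∈ FP` and `p ≥ K`. [cite: Goldreich2004, Construction 6.4.22] -/
theorem spec2_wf (hf : f ∈ FP) (hK : ∀ n, K n ≤ p.eval n) : (spec2 p f).WF := by
  refine ⟨?_, ?_, ?_, ?_, ?_, ?_, ?_, ?_, ?_, ?_⟩
  · rw [spec2_hb]; exact hashP_mem_FP p hf
  · intro n; rw [spec2_dLF, spec2_dL]; exact compile_d_apply n
  · intro n; rw [spec2_RF, spec2_R]; exact compile_Rtwo_apply n
  · rw [spec2_dLF, dLFd]; exact UExpr.compile₁_mem_FP E.d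
  · rw [spec2_RF, RFtwo]; exact UExpr.compile₁_mem_FP ERtwo
  · intro n; rw [spec2_R, spec2_PR]; exact Rtwo_le n
  · intro n; rw [spec2_R, spec2_p, spec2_p₂]; exact Rtwo_succ_mul_le p n
  · intro n; rw [spec2_p]; exact (one_le_K n).trans (hK n)
  · intro n; rw [spec2_dL]; exact two_le_d n
  · intro n r x hr _; rw [spec2_p] at hr; rw [spec2_hb, spec2_dL]; exact length_hashP_idx n hr x

/-- **`HHRVW.family p f` is a leveled restricted UOWHF** for a length-preserving one-way `f` and `p ≥ K`.
[cite: HaitnerEtAl2020, Thm. 5.1; Goldreich2004, Def. 6.4.19] -/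
theorem isLeveledRUOWHF_family (hf : IsOneWay f) (hlp : IsLengthPreserving f) (hK : ∀ n, K n ≤ p.eval n) :
    (family p f).IsLeveledRUOWHF (dLen p) (rLen p) :=
  let h := family_leveled_ruowhf (p := p) hf hlp hK
  ⟨h.1, h.2.1, h.2.2.2.2⟩

variable (p f)

/-- **The factor-two composition** of `HHRVW.family p f`. [cite: Goldreich2004, Construction 6.4.22] -/
noncomputable def compose2 : HashCollection := MDCompose.compose (spec2 p f)

/-- Its domain length at index length `L`. [cite: Goldreich2004, Construction 6.4.22] -/
noncomputable def dLen2 : ℕ → ℕ := MDCompose.dLenC (spec2 p f)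

/-- Its range length at index length `L`. [cite: Goldreich2004, Construction 6.4.22] -/
noncomputable def rLen2 : ℕ → ℕ := MDCompose.rLenC (spec2 p f)

variable {p f}

/-- **Factor two**: `dLen2 = 2 · rLen2` at every index length. [cite: Goldreich2004, Construction 6.4.22 (a `(d', d'/2)`-UOWHF)] -/
theorem dLen2_eq (L : ℕ) : dLen2 p f L = 2 * rLen2 p f L := by
  have := two_le_d (LenPres.nOf (Pd * p) L)
  show d (LenPres.nOf (Pd * p) L) + Rtwo (LenPres.nOf (Pd * p) L) = 2 * (d (LenPres.nOf (Pd * p) L) - 1)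
  rw [Rtwo]; omega

/-- The range length of the composition is `d − 1` at the level of the index. [folklore] -/
theorem rLen2_eq (L : ℕ) : rLen2 p f L = d (LenPres.nOf (Pd * p) L) - 1 := rfl

/-- **OWF ⇒ a leveled factor-two restricted UOWHF**: for a length-preserving one-way `f` and `p ≥ K`, the composed
collection `compose2 p f` (indices `1ⁿ0r`, `|r| = Pd(n)·p(n)`) is a leveled restricted UOWHF mapping `{0,1}^{2(d−1)}` to
`{0,1}^{d−1}` at level `n`. [cite: Goldreich2004, Prop. 6.4.23 with Thm. 6.4.29; HaitnerEtAl2020, Thm. 5.1] -/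
theorem isLeveledRUOWHF_compose2 (hf : IsOneWay f) (hlp : IsLengthPreserving f) (hK : ∀ n, K n ≤ p.eval n) :
    (compose2 p f).IsLeveledRUOWHF (dLen2 p f) (rLen2 p f) :=
  MDCompose.isLeveledRUOWHF_compose (spec2_wf hf.1 hK) (dB := dLen p) (rB := rLen p)
    (fun n => by
      show d (LenPres.nOf p (LenPres.M p n)) = d n
      rw [LenPres.nOf_eq le_rfl (LenPres.M_strictMono (Nat.lt_succ_self n))])
    (by rw [base_spec2]; exact isLeveledRUOWHF_family hf hlp hK)

/-- Indices of `compose2 p f` at parameter `n` have length `M_{Pd·p}(n)`. [cite: Goldreich2004, Def. 6.4.19 (1)] -/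
theorem length_index_compose2 {n : ℕ} {s : List Bool} (hs : s ∈ ((compose2 p f).indexPMF n).support) :
    s.length = LenPres.M (Pd * p) n :=
  MDCompose.length_index_compose _ hs

/-- **Existence form**: one-way functions give leveled factor-two restricted UOWHFs (with `p`-shaped indices, a
positive range at every level and the range length on all inputs). [cite: Goldreich2004, Prop. 6.4.23 with Thm. 6.4.29] -/
theorem exists_leveled_halving_ruowhf_of_OWFExist (h : OWFExist) :
    ∃ (H : HashCollection) (dL rL : ℕ → ℕ) (P : Polynomial ℕ), H.IsLeveledRUOWHF dL rL ∧ (∀ L, dL L = 2 * rL L) ∧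
      (∀ n, 1 ≤ rL (LenPres.M P n)) ∧ (∀ n, ∀ s ∈ (H.indexPMF n).support, s.length = LenPres.M P n) ∧
      (∀ s x : List Bool, (H.hash s x).length = rL s.length) := by
  obtain ⟨f, hf, hlp⟩ := h.exists_isLengthPreserving
  obtain ⟨p, hp⟩ := UExpr.exists_poly_le₁ E.K
  have hK : ∀ n, K n ≤ p.eval n := fun n => by have h := hp n; simp only [E.K_eval] at h; exact h
  refine ⟨compose2 p f, dLen2 p f, rLen2 p f, Pd * p, isLeveledRUOWHF_compose2 hf hlp hK, dLen2_eq,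
    fun n => ?_, fun n s hs => length_index_compose2 hs, fun s x => MDCompose.length_compose_hash _ (spec2_wf hf.1 hK) s x⟩
  rw [rLen2_eq, LenPres.nOf_eq le_rfl (LenPres.M_strictMono (Nat.lt_succ_self n))]
  have := two_le_d n; omega

end HHRVW

end Literature.Computability.Cryptography
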